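import Summits.QuantumFields.BalabanUV.Beta.TorusBoxProfile
import Summits.QuantumFields.BalabanUV.Beta.SubsolutionMeanValue

/-!
# `Summit.QuantumFields.BalabanUV.Beta.TorusBoxSupersolution` — engine file 15b: the QUADRATIC UNIT SUPERSOLUTION of the free
# lattice Laplacian on a coordinate box of the unit torus (item (DS) of the owner's decomposition E-an4-141a of O.2 item (ii-b)),
# in the interface of road P3's reduction `SubsolutionMeanValue` (co-owner beta-d4-p3, gen 12): `w₀ ≥ 0`, `1 + N w₀ ≤ W·w₀` on the
# box, `w₀ ≤ (r+1)²/(2c₀²)` — and the END `fibreNorm_le_l2_box`: on the torus with a constant bond weight the local-regularity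
# SHAPE `‖f(x₀,·)‖ ≤ C·√#B′·‖f‖_{ℓ²(B′)} + m′·(r+1)²/(2c₀²)` follows from the L¹ mean-value binder ALONE

HONEST FRAMING (page 1 of everything in this cell).  Discharging `FlowStep.BetaPertH` would make Bałaban's ultraviolet
stability UNCONDITIONAL — a constructive-QFT result; it is NOT the continuum limit and NOT the Clay problem.  This module
discharges nothing of `BetaPertH`; it is [folklore] lattice bookkeeping, kernel-checked, by the OWNER of binder row D4 (unit
`b2b-balaban-beta-an4`, gen 45).  HONEST DEPENDENCY: continuum YM on T⁴ ⇐ BetaPertH ∧ nine spine estimates (0/9 proved);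
BetaPertH ⇐ (D1) ∧ (D4) ∧ CAP+tail; G-an2-4 gates asym, D1 and NE2/3/4.

THE POINT.  After file 12 (Kato), file 14 (comparison) and beta-d4-p3's `SubsolutionMeanValue` (a nonnegative sub-solution `u` of
the free weighted graph Laplacian with source `≤ m′` on `B` has `u(p) ≤ Φ(u) + m′·w₀(p)` for ANY nonnegative UNIT SUPERSOLUTION
`w₀` — `1 + N w₀ ≤ W·w₀` on `B` — and any monotone `Φ` carrying the MEAN-VALUE BINDER at `(B,p)`), the datum `hreg` of file 9b for
the bare covariant Laplacian needs two inputs: the binder (MV) and the object `w₀` (DS).  THIS FILE supplies (DS) on the MODEL's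
carrier, the unit torus `UT N = Π_μ ℤ/N_μ` with bonds `bsrc (x,μ) = x`, `btgt (x,μ) = x + e_μ` and a CONSTANT bond weight
`c ≡ c₀ ≠ 0` (print's `η⁻¹`; uniform ellipticity enters HERE — for a general weight `|c_b| ≤ c_max` the quadratic profile is not
a supersolution): on the box `B = {x : dist(x,x₀) ≤ r}` (`dist` = sup of the circular coordinate distances `δ_μ(x,x₀)`) with
`2r + 2 ≤ N_μ` for all `μ` (no wrap-around one step beyond the box), `w₀ = max(d(r+1)² − Σ_μ δ_μ², 0)/(2d·c₀²)` satisfies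
`0 ≤ w₀ ≤ (r+1)²/(2c₀²)` everywhere and `1 + N w₀ = W·w₀` (so `≤`) on `B`, because `δ_μ(x ± e_μ, x₀) = dist(t_μ ± 1, N_μℤ)`
(`t_μ = x_μ − x₀,μ`) and below half the period `dist(t+1)² + dist(t−1)² = 2·dist(t)² + 2`, i.e. `Σ_{y∼x}(φ(y) − φ(x)) = 2d` for
`φ = Σ_μ δ_μ²`.  The END `fibreNorm_le_l2_box` plugs `w₀` into beta-d4-p3's `fibreNorm_le_l2_add`: for ANY column-orthonormal `Rm`
and any field `f` with `‖(D*Df)(x,·)‖ ≤ m′` on `B`, the L¹ mean-value binder at `(B, x₀)` with constant `C` over `B′` gives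
`‖f(x₀,·)‖ ≤ C·√#B′·√(Σ_{x∈B′}Σ_i f(x,i)²) + m′·(r+1)²/(2c₀²)` — `hreg`'s two terms for `D*D` on the torus, NO Dirichlet solve.
What remains of (ii-b) for the MODEL after this file: the binder (MV) — the L¹ mean-value inequality at the centre for nonnegative
sub-harmonic functions of the FREE Laplacian on lattice boxes, constant uniform in `r` (classical discrete potential theory ∕
Moser iteration on graphs; NOT in the tree; XL in kernel) — and, for `levelOp`, the box ∕ `d_n`-ball sandwich under the grading
plus the (P) budget of file 10a (the owner's file 16).

WHAT IS CERTIFIED (kernel, 0 sorry; no `def` — `φ` and `w₀` enter through defining hypotheses `hφ`, `hw₀` and are instantiated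
in `exists_unit_supersolution_box`; the profile facts are file 15a `TorusBoxProfile`): §4 the bond sums at a torus site for a
constant weight (`sum_src_const`, `sum_tgt_const`, `wsum_src_const`, `wsum_tgt_const`: `W(x) = 2d·c₀²`,
`(Nw)(x) = c₀²·Σ_μ (w(x−e_μ) + w(x+e_μ))`, via beta-d4-p2's `sum_ite_bsrc_eq`∕`sum_ite_btgt_eq`); §5 **`w₀_nonneg`**, **`w₀_le`**,
**`unit_supersolution_box`**, **`exists_unit_supersolution_box`**; §6 **`fibreNorm_le_l2_box`** (the END over beta-d4-p3's
`fibreNorm_le_l2_add`).  LOCATORS (shape only; ABSOLUTE RULE — nothing printed is asserted): [Balaban1985BackgroundPropagators]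
(3.23) p. 394, Thm 3.1 (3.42) p. 397; [Balaban1984PropagatorsI] p. 36.  Row D4: NO class change (critical-path width 0; D4
DISCHARGE NO DATE); NOT BetaPertH, NOT continuum, NOT Clay, NOT summit progress.
-/

open scoped BigOperators
open Finset

namespace Summit.QuantumFields.BalabanUV.Beta.TorusBoxSupersolution

open Literature.MathematicalPhysics.QuantumFieldTheory.Balaban1983to89
open Literature.MathematicalPhysics.QuantumFieldTheory.Balaban1983to89.B9Thm37GluePU (bsrc btgt bsrc_apply btgt_apply)
open Literature.MathematicalPhysics.QuantumFieldTheory.Balaban1983to89.B9Thm37Glue (covD covDT)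
open B4TorusKernel.MultiPeriod (circAbs)
open B5TorusCover (UT)
open B5Leibniz121 (up dn)
open Summit.QuantumFields.BalabanUV.Beta.MultiscaleRemainderLapTorus (sum_ite_bsrc_eq sum_ite_btgt_eq)
open Summit.QuantumFields.BalabanUV.Beta.SubsolutionMeanValue (fibreNorm_le_l2_add)
open Summit.QuantumFields.BalabanUV.Beta.TorusBoxProfile

noncomputable section

section Torus

variable {d : ℕ} {N : Fin d → ℕ} [∀ i, NeZero (N i)]

/-! ## §4 The bond sums at a torus site for a constant bond weight -/

omit [∀ i, NeZero (N i)] in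
/-- `Σ_{b : bsrc b = x} c_b² = d·c₀²`. [folklore] -/
theorem sum_src_const {c : UT N × Fin d → ℝ} {c₀ : ℝ} (hc : ∀ b, c b = c₀) (x : UT N) :
    ∑ b ∈ univ.filter (fun b : UT N × Fin d => bsrc b = x), c b ^ 2 = d * c₀ ^ 2 := by
  rw [Finset.sum_filter, sum_ite_bsrc_eq x (fun b => c b ^ 2)]
  simp only [hc, Finset.sum_const, Finset.card_univ, Fintype.card_fin, nsmul_eq_mul]

/-- `Σ_{b : btgt b = x} c_b² = d·c₀²`. [folklore] -/
theorem sum_tgt_const {c : UT N × Fin d → ℝ} {c₀ : ℝ} (hc : ∀ b, c b = c₀) (x : UT N) :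
    ∑ b ∈ univ.filter (fun b : UT N × Fin d => btgt b = x), c b ^ 2 = d * c₀ ^ 2 := by
  rw [Finset.sum_filter, sum_ite_btgt_eq x (fun b => c b ^ 2)]
  simp only [hc, Finset.sum_const, Finset.card_univ, Fintype.card_fin, nsmul_eq_mul]

/-- `Σ_{b : bsrc b = x} c_b²·w(btgt b) = c₀²·Σ_μ w(x + e_μ)`. [folklore] -/
theorem wsum_src_const {c : UT N × Fin d → ℝ} {c₀ : ℝ} (hc : ∀ b, c b = c₀) (w : UT N → ℝ) (x : UT N) :
    ∑ b ∈ univ.filter (fun b : UT N × Fin d => bsrc b = x), c b ^ 2 * w (btgt b) = c₀ ^ 2 * ∑ μ, w (up x μ) := by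
  rw [Finset.sum_filter, sum_ite_bsrc_eq x (fun b => c b ^ 2 * w (btgt b)), Finset.mul_sum]
  simp only [hc, btgt_apply]

/-- `Σ_{b : btgt b = x} c_b²·w(bsrc b) = c₀²·Σ_μ w(x − e_μ)`. [folklore] -/
theorem wsum_tgt_const {c : UT N × Fin d → ℝ} {c₀ : ℝ} (hc : ∀ b, c b = c₀) (w : UT N → ℝ) (x : UT N) :
    ∑ b ∈ univ.filter (fun b : UT N × Fin d => btgt b = x), c b ^ 2 * w (bsrc b) = c₀ ^ 2 * ∑ μ, w (dn x μ) := by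
  rw [Finset.sum_filter, sum_ite_btgt_eq x (fun b => c b ^ 2 * w (bsrc b)), Finset.mul_sum]
  simp only [hc, bsrc_apply]

/-! ## §5 THE UNIT SUPERSOLUTION `w₀ = max(d(r+1)² − φ, 0)/(2d·c₀²)` -/

omit [∀ i, NeZero (N i)] in
/-- `w₀ ≥ 0` everywhere. [folklore] -/
theorem w₀_nonneg (c₀ : ℝ) (r : ℕ) (φ w₀ : UT N → ℝ)
    (hw₀ : ∀ x, w₀ x = max ((d : ℝ) * ((r : ℝ) + 1) ^ 2 - φ x) 0 / (2 * d * c₀ ^ 2)) (y : UT N) : 0 ≤ w₀ y := by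
  rw [hw₀]
  exact div_nonneg (le_max_right _ _) (by positivity)

omit [∀ i, NeZero (N i)] in
/-- `w₀ ≤ (r+1)²/(2c₀²)` everywhere (`φ ≥ 0`; `d ≥ 1`, `c₀ ≠ 0`). [folklore] -/
theorem w₀_le [NeZero d] {c₀ : ℝ} (hc₀ : c₀ ≠ 0) (x₀ : UT N) (r : ℕ) (φ w₀ : UT N → ℝ)
    (hφ : ∀ x, φ x = ∑ ν, (circAbs (N ν) (((UT.toSite N x ν).val : ℤ) - ((UT.toSite N x₀ ν).val : ℤ)) : ℝ) ^ 2)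
    (hw₀ : ∀ x, w₀ x = max ((d : ℝ) * ((r : ℝ) + 1) ^ 2 - φ x) 0 / (2 * d * c₀ ^ 2)) (y : UT N) :
    w₀ y ≤ ((r : ℝ) + 1) ^ 2 / (2 * c₀ ^ 2) := by
  have hd : (0 : ℝ) < d := by exact_mod_cast Nat.pos_of_ne_zero (NeZero.ne d)
  have hc2 : (0 : ℝ) < c₀ ^ 2 := by positivity
  have hφ0 := profile_nonneg x₀ φ hφ y
  rw [hw₀, div_le_div_iff₀ (by positivity) (by positivity)]
  have hmax : max ((d : ℝ) * ((r : ℝ) + 1) ^ 2 - φ y) 0 ≤ (d : ℝ) * ((r : ℝ) + 1) ^ 2 :=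
    max_le (by linarith) (by positivity)
  calc max ((d : ℝ) * ((r : ℝ) + 1) ^ 2 - φ y) 0 * (2 * c₀ ^ 2) ≤ (d : ℝ) * ((r : ℝ) + 1) ^ 2 * (2 * c₀ ^ 2) :=
        mul_le_mul_of_nonneg_right hmax (by positivity)
    _ = ((r : ℝ) + 1) ^ 2 * (2 * d * c₀ ^ 2) := by ring

/-- **`w₀` IS A UNIT SUPERSOLUTION ON THE BOX**: for a constant bond weight `c ≡ c₀ ≠ 0` and `2r + 2 ≤ N_μ` for all `μ`, at every
`x` with `dist(x, x₀) ≤ r`: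
`1 + Σ_{btgt b = x} c_b²·w₀(bsrc b) + Σ_{bsrc b = x} c_b²·w₀(btgt b) ≤ (Σ_{btgt b = x} c_b² + Σ_{bsrc b = x} c_b²)·w₀(x)`
(in fact with equality: `W·w₀ − N w₀ = Σ_μ(φ(x+e_μ) + φ(x−e_μ) − 2φ(x))/(2d) = 1`, the positive parts being inactive on the box
and one step beyond it) — the hypothesis `hw₀` of beta-d4-p3's `SubsolutionMeanValue.subsolution_le_meanValue_unit` ∕
`fibreNorm_le_meanValue` with `src := bsrc`, `tgt := btgt`. [cite: Balaban1985BackgroundPropagators, (3.23) p.394] [folklore] -/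
theorem unit_supersolution_box [NeZero d] {c : UT N × Fin d → ℝ} {c₀ : ℝ} (hc : ∀ b, c b = c₀) (hc₀ : c₀ ≠ 0)
    (x₀ : UT N) {r : ℕ} (hr : ∀ μ, 2 * r + 2 ≤ N μ) (φ w₀ : UT N → ℝ)
    (hφ : ∀ x, φ x = ∑ ν, (circAbs (N ν) (((UT.toSite N x ν).val : ℤ) - ((UT.toSite N x₀ ν).val : ℤ)) : ℝ) ^ 2)
    (hw₀ : ∀ x, w₀ x = max ((d : ℝ) * ((r : ℝ) + 1) ^ 2 - φ x) 0 / (2 * d * c₀ ^ 2)) :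
    ∀ x ∈ univ.filter (fun x : UT N => dist x x₀ ≤ r),
      1 + ((∑ b ∈ univ.filter (fun b : UT N × Fin d => btgt b = x), c b ^ 2 * w₀ (bsrc b)) +
            ∑ b ∈ univ.filter (fun b : UT N × Fin d => bsrc b = x), c b ^ 2 * w₀ (btgt b)) ≤
        ((∑ b ∈ univ.filter (fun b : UT N × Fin d => btgt b = x), c b ^ 2) +
            ∑ b ∈ univ.filter (fun b : UT N × Fin d => bsrc b = x), c b ^ 2) * w₀ x := by
  intro x hx
  have hxr : dist x x₀ ≤ r := (mem_filter.mp hx).2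
  have hd : (0 : ℝ) < d := by exact_mod_cast Nat.pos_of_ne_zero (NeZero.ne d)
  have hc2 : (0 : ℝ) < c₀ ^ 2 := by positivity
  set K : ℝ := (d : ℝ) * ((r : ℝ) + 1) ^ 2 with hK
  -- the positive parts are inactive at `x` and at its neighbours
  have hr1 : (r : ℝ) ^ 2 ≤ ((r : ℝ) + 1) ^ 2 := by nlinarith
  have hKx : φ x ≤ K := (profile_le_of_mem x₀ φ hφ hxr).trans (mul_le_mul_of_nonneg_left hr1 hd.le)
  have wx : w₀ x = (K - φ x) / (2 * d * c₀ ^ 2) := by rw [hw₀, max_eq_left (sub_nonneg.mpr hKx)]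
  have wup : ∀ μ, w₀ (up x μ) = (K - φ (up x μ)) / (2 * d * c₀ ^ 2) := fun μ => by
    rw [hw₀, max_eq_left (sub_nonneg.mpr (profile_up_le x₀ φ hφ hxr μ))]
  have wdn : ∀ μ, w₀ (dn x μ) = (K - φ (dn x μ)) / (2 * d * c₀ ^ 2) := fun μ => by
    rw [hw₀, max_eq_left (sub_nonneg.mpr (profile_dn_le x₀ φ hφ hxr μ))]
  -- the bond sums
  rw [wsum_tgt_const hc, wsum_src_const hc, sum_tgt_const hc, sum_src_const hc]
  -- the neighbour values summed: `Σ_μ (w₀(x−e_μ) + w₀(x+e_μ)) = (2dK − (2dφ(x) + 2d))/(2dc₀²)`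
  have hlap := sum_profile_up_add_dn x₀ φ hφ hr hxr
  have hnb : ∑ μ, w₀ (dn x μ) + ∑ μ, w₀ (up x μ) = (2 * d * K - (2 * d * φ x + 2 * d)) / (2 * d * c₀ ^ 2) := by
    rw [← Finset.sum_add_distrib]
    have h1 : ∑ μ, (w₀ (dn x μ) + w₀ (up x μ)) = ∑ μ, ((2 * K - (φ (up x μ) + φ (dn x μ))) / (2 * d * c₀ ^ 2)) :=
      Finset.sum_congr rfl fun μ _ => by rw [wup, wdn]; ring
    rw [h1, ← Finset.sum_div, Finset.sum_sub_distrib, hlap, Finset.sum_const, Finset.card_univ, Fintype.card_fin,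
      nsmul_eq_mul]
    ring
  rw [← mul_add, hnb, wx]
  apply le_of_eq
  field_simp
  ring

/-- **EXISTENCE OF A UNIT SUPERSOLUTION ON A TORUS BOX** (item (DS) of E-an4-141a, packaged for consumers): constant bond weight
`c ≡ c₀ ≠ 0`, `d ≥ 1`, `2r + 2 ≤ N_μ` for every `μ`; then there is `w₀ : UT N → ℝ` with `0 ≤ w₀ ≤ (r+1)²/(2c₀²)` everywhere and
`1 + N w₀ ≤ W·w₀` at every site of the box `dist(·, x₀) ≤ r`. [folklore] -/
theorem exists_unit_supersolution_box [NeZero d] {c : UT N × Fin d → ℝ} {c₀ : ℝ} (hc : ∀ b, c b = c₀) (hc₀ : c₀ ≠ 0)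
    (x₀ : UT N) {r : ℕ} (hr : ∀ μ, 2 * r + 2 ≤ N μ) :
    ∃ w₀ : UT N → ℝ, (∀ y, 0 ≤ w₀ y) ∧ (∀ y, w₀ y ≤ ((r : ℝ) + 1) ^ 2 / (2 * c₀ ^ 2)) ∧
      ∀ x ∈ univ.filter (fun x : UT N => dist x x₀ ≤ r),
        1 + ((∑ b ∈ univ.filter (fun b : UT N × Fin d => btgt b = x), c b ^ 2 * w₀ (bsrc b)) +
              ∑ b ∈ univ.filter (fun b : UT N × Fin d => bsrc b = x), c b ^ 2 * w₀ (btgt b)) ≤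
          ((∑ b ∈ univ.filter (fun b : UT N × Fin d => btgt b = x), c b ^ 2) +
              ∑ b ∈ univ.filter (fun b : UT N × Fin d => bsrc b = x), c b ^ 2) * w₀ x := by
  set φ : UT N → ℝ := fun x =>
    ∑ ν, (circAbs (N ν) (((UT.toSite N x ν).val : ℤ) - ((UT.toSite N x₀ ν).val : ℤ)) : ℝ) ^ 2 with hφ
  set w₀ : UT N → ℝ := fun x => max ((d : ℝ) * ((r : ℝ) + 1) ^ 2 - φ x) 0 / (2 * d * c₀ ^ 2) with hw₀
  exact ⟨w₀, w₀_nonneg c₀ r φ w₀ (fun _ => rfl), w₀_le hc₀ x₀ r φ w₀ (fun _ => rfl) (fun _ => rfl),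
    unit_supersolution_box hc hc₀ x₀ hr φ w₀ (fun _ => rfl) (fun _ => rfl)⟩

/-! ## §6 END: `hreg`'s SHAPE for `D*D` on the torus from the L¹ mean-value binder ALONE -/

/-- **THE LOCAL-REGULARITY SHAPE ON A TORUS BOX FROM THE MEAN-VALUE BINDER ALONE.**  Unit torus `UT N` (`d ≥ 1`), bonds
`bsrc∕btgt`, constant weight `c ≡ c₀ ≠ 0`, ANY column-orthonormal bond matrices `Rm`, a centre `x₀` and a radius `r` with
`2r + 2 ≤ N_μ`; write `B = {x : dist(x,x₀) ≤ r}`.  ASSUME the L¹ mean-value binder at `(B, x₀)` with constant `C ≥ 0` over a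
finite set `B′`: every `z ≥ 0` with `W·z ≤ Nz` on `B` has `z(x₀) ≤ C·Σ_{B′} z` ((MV) — a HYPOTHESIS, the classical interior
estimate for free sub-harmonic functions; ABSOLUTE RULE).  Then for every field `f` with `√(Σ_i ((D*Df)(x,i))²) ≤ m′` on `B`
(`m′ ≥ 0`): `√(Σ_i f(x₀,i)²) ≤ C·√#B′·√(Σ_{x∈B′}Σ_i f(x,i)²) + m′·(r+1)²/(2c₀²)` — beta-d4-p3's `fibreNorm_le_l2_add` with
§5's `w₀`.  After this END, (ii-b) for the bare covariant Laplacian on the torus IS the binder (MV) and nothing else.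
[cite: Balaban1985BackgroundPropagators, Thm 3.1 (3.42) p.397 + (3.23) p.394] [folklore] -/
theorem fibreNorm_le_l2_box [NeZero d] {Cp : Type} [Fintype Cp] [DecidableEq Cp] {c : UT N × Fin d → ℝ} {c₀ : ℝ}
    (hc : ∀ b, c b = c₀) (hc₀ : c₀ ≠ 0) (Rm : UT N × Fin d → Cp → Cp → ℝ)
    (hRm : ∀ b i j, ∑ k, Rm b k i * Rm b k j = if i = j then (1 : ℝ) else 0) (f : UT N × Cp → ℝ)
    (x₀ : UT N) {r : ℕ} (hr : ∀ μ, 2 * r + 2 ≤ N μ) (B' : Finset (UT N)) {C : ℝ} (hC : 0 ≤ C)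
    (hMV : ∀ z : UT N → ℝ, (∀ y, 0 ≤ z y) →
      (∀ x ∈ univ.filter (fun x : UT N => dist x x₀ ≤ r),
        ((∑ b ∈ univ.filter (fun b : UT N × Fin d => btgt b = x), c b ^ 2) +
            ∑ b ∈ univ.filter (fun b : UT N × Fin d => bsrc b = x), c b ^ 2) * z x ≤
          ((∑ b ∈ univ.filter (fun b : UT N × Fin d => btgt b = x), c b ^ 2 * z (bsrc b)) +
            ∑ b ∈ univ.filter (fun b : UT N × Fin d => bsrc b = x), c b ^ 2 * z (btgt b))) →
      z x₀ ≤ C * ∑ x ∈ B', z x)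
    {m' : ℝ} (hm' : 0 ≤ m')
    (hsrc : ∀ x ∈ univ.filter (fun x : UT N => dist x x₀ ≤ r),
      Real.sqrt (∑ i, (covDT bsrc btgt c Rm (covD bsrc btgt c Rm f) (x, i)) ^ 2) ≤ m') :
    Real.sqrt (∑ i, f (x₀, i) ^ 2) ≤
      C * Real.sqrt (B'.card) * Real.sqrt (∑ x ∈ B', ∑ i, f (x, i) ^ 2) + m' * (((r : ℝ) + 1) ^ 2 / (2 * c₀ ^ 2)) := by
  obtain ⟨w₀, h0, hle, hsup⟩ := exists_unit_supersolution_box hc hc₀ x₀ hr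
  have h := fibreNorm_le_l2_add bsrc btgt c Rm hRm f (univ.filter (fun x : UT N => dist x x₀ ≤ r)) B' x₀ hC hMV w₀ h0
    hsup hm' hsrc
  have h2 := mul_le_mul_of_nonneg_left (hle x₀) hm'
  linarith

end Torus

end

end Summit.QuantumFields.BalabanUV.Beta.TorusBoxSupersolution
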